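import Summits.ValiantsHypothesis.ValiantsHypothesis.Theorems.SymPencilPerFourPairingHyperplane
import Summits.ValiantsHypothesis.ValiantsHypothesis.Theorems.SymPencilPerFourLowRankSeven

/-!
# Route `SymPencil` — six-dimensional subspaces of a cross have `rank Hess per_4 ≥ 6` somewhere
# (brick (C) of the `(10, 6)` cell of `Cruxes/SdcSuperquadratic/NEXT-RUNG-25.md`;
# `--supports` stmt-ValiantsHypothesis-5674 `SdcSuperquadratic`; rung currency only)

**Theorem** (`false_of_le_cross_six_of_sum_sq_swap`).  Over a field of characteristic `0`, let
`V` be a `6`-dimensional linear subspace of a CROSS `X_{lc}` (support in row `l ∪` column `c`).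
Then not every `y ∈ V` has the swapped property with `< 6` squares (the `s²`-coefficient of
`per_4 (u + s y)` a sum of `< 6` weighted squares of linear functionals of `u`, i.e.
`rank (Hess per_4)(y) ≤ 5`).

Proof (after moving the cross to `(3, 3)`, `false_of_le_cross33_six_of_sum_sq_swap`).  Write
`a_j = y_{3j}` (row) and `b_i = y_{i3}` (column arms).  Val-width-5674-p2's pointwise minors
(`SymPencilPerFourHessianMinors.prod_perm_col_eq_zero_of_sum_sq_swap`) for the rows `(3, i)` and
the column `3` read, on the cross, `a₀ a₁ a₂ · b_i³ = 0`; for the transposed matrix (same swapped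
property, `SymPencilPerFourLowRankSeven.sqFamilySwap_map`) `b₀ b₁ b₂ · a_j³ = 0`.  A product of
linear forms vanishing on `V` has a factor vanishing on `V`
(`SymPencilPerFourPairingHyperplane.exists_forall_eq_zero_of_prod_eq_zero`), so some arm
coordinate vanishes identically on `V`; as `dim V = 6` the space `V` then IS the span of the other
six cross cells and contains their indicator, at which another of the products equals `1`.
(For orientation: for `y ∈ X₃₃` and `u` on the `3 × 3` block the `s²`-coefficient is the
Kronecker form `B(b) ⊗ A(a)` of the two zero-diagonal `3 × 3` matrices of the arms, of rank
`∈ {0, 4, 6, 9}`.)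

Use: the case "`V` inside a cross" of the conjectural `6`-dimensional structure theorem T6″ for the
cell `(r, dim V, d) = (10, 6, 4/5)`.  Honest framing: a lemma; `sdc(per_4) ≥ 25` is the tree's
value; the crux `SdcSuperquadratic` and `VP ≠ VNP` are untouched.  No definitions, no named facts.
[folklore]
-/

noncomputable section

-- single-conjunct layout: Sub = Summit, duplicated namespace component intended
set_option linter.dupNamespace false

namespace Summit.ValiantsHypothesis.ValiantsHypothesis.Theorems.SymPencilPerFourSixDimCross

open Matrix MvPolynomial Finset Module
open Literature.Computability.AlgebraicComplexity
open Literature.Computability.AlgebraicComplexity.AlperBogartVelasco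
open Summit.ValiantsHypothesis.ValiantsHypothesis.Theorems.SymPencilPerFourBlocks
open Summit.ValiantsHypothesis.ValiantsHypothesis.Theorems.SymPencilPerFourHessianMinors
open Summit.ValiantsHypothesis.ValiantsHypothesis.Theorems.SymPencilPerFourPairingHyperplane
open Summit.ValiantsHypothesis.ValiantsHypothesis.Theorems.SymPencilPerFourLowRankSeven
open Summit.ValiantsHypothesis.ValiantsHypothesis.Theorems.SymPencilPerFourTwoRowsRadical

variable {K : Type*} [Field K]

/-! ### The cross at `(3, 3)` -/

/-- **Row products on the cross `X₃₃`.**  If `y ∈ X₃₃` has the swapped property with `|ι| < 6`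
squares then `(a₂ b_i)(a₁ b_i)(a₀ b_i) = 0` for every arm row `i ≠ 3` (`a_j = y_{3j}`,
`b_i = y_{i3}`). [folklore] -/
theorem rowProd_eq_zero_of_cross33 [CharZero K] {ι : Type*} [Fintype ι] (hι : Fintype.card ι < 6)
    (y : Fin 4 × Fin 4 → K) (hy : ∀ i j : Fin 4, i ≠ 3 → j ≠ 3 → y (i, j) = 0)
    (h : ∃ (c : ι → K) (Λ : ι → ((Fin 4 × Fin 4 → K) →ₗ[K] K)),
      ∀ u : Fin 4 × Fin 4 → K, ∃ e₀ e₁ : K, ∀ s : K,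
        eval (u + s • y) (perPoly (Fin 4) K) = e₀ + s * e₁ + s ^ 2 * ∑ k, c k * (Λ k u) ^ 2)
    (i : Fin 4) (hi : i ≠ 3) :
    (y (3, 2) * y (i, 3)) * (y (3, 1) * y (i, 3)) * (y (3, 0) * y (i, 3)) = 0 := by
  have hp := prod_perm_col_eq_zero_of_sum_sq_swap hι y h 3 i 3 (Ne.symm hi)
  simp only [Equiv.swap_self, Equiv.refl_apply] at hp
  rw [hy i 2 hi (by decide), hy i 1 hi (by decide), hy i 0 hi (by decide)] at hp
  simpa using hp

/-- **Pointwise transport of the swapped property** along a `per_4`-preserving linear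
automorphism (the functionals of the base point are pulled back along `Φ⁻¹`). [folklore] -/
theorem sum_sq_swap_map_point {ι : Type*} [Fintype ι]
    (Φ : (Fin 4 × Fin 4 → K) ≃ₗ[K] (Fin 4 × Fin 4 → K))
    (hΦ : ∀ z, eval (Φ z) (perPoly (Fin 4) K) = eval z (perPoly (Fin 4) K))
    {y : Fin 4 × Fin 4 → K}
    (h : ∃ (c : ι → K) (Λ : ι → ((Fin 4 × Fin 4 → K) →ₗ[K] K)),
      ∀ u : Fin 4 × Fin 4 → K, ∃ e₀ e₁ : K, ∀ s : K,
        eval (u + s • y) (perPoly (Fin 4) K) = e₀ + s * e₁ + s ^ 2 * ∑ k, c k * (Λ k u) ^ 2) :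
    ∃ (c : ι → K) (Λ : ι → ((Fin 4 × Fin 4 → K) →ₗ[K] K)),
      ∀ u : Fin 4 × Fin 4 → K, ∃ e₀ e₁ : K, ∀ s : K,
        eval (u + s • Φ y) (perPoly (Fin 4) K) = e₀ + s * e₁ + s ^ 2 * ∑ k, c k * (Λ k u) ^ 2 := by
  have hfam := sqFamilySwap_map (ι := ι) (K ∙ y) Φ hΦ (fun z hz => ?_)
  · exact hfam (Φ y) ⟨y, Submodule.mem_span_singleton_self y, rfl⟩
  -- the swapped property is homogeneous: it passes to the multiples `t • y`
  obtain ⟨t, rfl⟩ := Submodule.mem_span_singleton.1 hz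
  obtain ⟨c, Λ, hcΛ⟩ := h
  refine ⟨c, fun k => t • Λ k, fun u => ?_⟩
  obtain ⟨e₀, e₁, he⟩ := hcΛ u
  refine ⟨e₀, t * e₁, fun s => ?_⟩
  have h1 := he (s * t)
  rw [mul_smul] at h1
  rw [h1]
  simp only [LinearMap.smul_apply, smul_eq_mul, mul_pow, Finset.mul_sum]
  refine congrArg₂ (· + ·) (by ring) (Finset.sum_congr rfl fun k _ => by ring)

/-- **Column products on the cross `X₃₃`** (transpose of `rowProd_eq_zero_of_cross33`):
`(b₂ a_j)(b₁ a_j)(b₀ a_j) = 0` for every arm column `j ≠ 3`. [folklore] -/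
theorem colProd_eq_zero_of_cross33 [CharZero K] {ι : Type*} [Fintype ι] (hι : Fintype.card ι < 6)
    (y : Fin 4 × Fin 4 → K) (hy : ∀ i j : Fin 4, i ≠ 3 → j ≠ 3 → y (i, j) = 0)
    (h : ∃ (c : ι → K) (Λ : ι → ((Fin 4 × Fin 4 → K) →ₗ[K] K)),
      ∀ u : Fin 4 × Fin 4 → K, ∃ e₀ e₁ : K, ∀ s : K,
        eval (u + s • y) (perPoly (Fin 4) K) = e₀ + s * e₁ + s ^ 2 * ∑ k, c k * (Λ k u) ^ 2)
    (j : Fin 4) (hj : j ≠ 3) :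
    (y (2, 3) * y (3, j)) * (y (1, 3) * y (3, j)) * (y (0, 3) * y (3, j)) = 0 := by
  -- the transposed matrix has the swapped property too
  set Φ : (Fin 4 × Fin 4 → K) ≃ₗ[K] (Fin 4 × Fin 4 → K) :=
    LinearEquiv.funCongrLeft K K (Equiv.prodComm (Fin 4) (Fin 4)) with hΦ
  have hΦa : ∀ (x : Fin 4 × Fin 4 → K) (i j : Fin 4), Φ x (i, j) = x (j, i) := fun x i j => rfl
  have ht := sum_sq_swap_map_point Φ eval_perPoly_transpose h
  have hp := prod_perm_col_eq_zero_of_sum_sq_swap hι (Φ y) ht 3 j 3 (Ne.symm hj)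
  simp only [Equiv.swap_self, Equiv.refl_apply, hΦa] at hp
  rw [hy 2 j (by decide) hj, hy 1 j (by decide) hj, hy 0 j (by decide) hj] at hp
  simpa using hp

/-- The seven cells of the cross `X₃₃`. [folklore] -/
theorem crossCells_card : (Finset.univ.filter fun p : Fin 4 × Fin 4 => p.1 = 3 ∨ p.2 = 3).card = 7 := by
  decide

/-- **A six-dimensional subspace of the cross `X₃₃` on which an arm coordinate vanishes contains
the indicator of the other six cross cells.** [folklore] -/
theorem indicator_mem_of_coord_vanish (V : Submodule K (Fin 4 × Fin 4 → K))
    (hX : ∀ x ∈ V, ∀ i j : Fin 4, i ≠ 3 → j ≠ 3 → x (i, j) = 0) (h6 : finrank K V = 6)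
    (x₁ : Fin 4 × Fin 4) (hx₁ : x₁.1 = 3 ∨ x₁.2 = 3) (hV0 : ∀ y ∈ V, y x₁ = 0) :
    (fun p : Fin 4 × Fin 4 => if (p.1 = 3 ∨ p.2 = 3) ∧ p ≠ x₁ then (1 : K) else 0) ∈ V := by
  classical
  set T : Finset (Fin 4 × Fin 4) :=
    (Finset.univ.filter fun p : Fin 4 × Fin 4 => p.1 = 3 ∨ p.2 = 3).erase x₁ with hTdef
  have memT : ∀ p, p ∈ T ↔ (p.1 = 3 ∨ p.2 = 3) ∧ p ≠ x₁ := fun p => by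
    rw [hTdef, Finset.mem_erase, Finset.mem_filter]
    simp only [Finset.mem_univ, true_and]
    tauto
  have hx₁T : x₁ ∈ Finset.univ.filter (fun p : Fin 4 × Fin 4 => p.1 = 3 ∨ p.2 = 3) :=
    Finset.mem_filter.2 ⟨Finset.mem_univ _, hx₁⟩
  have hTcard : T.card = 6 := by
    rw [hTdef, Finset.card_erase_of_mem hx₁T, crossCells_card]
  set C : Submodule K (Fin 4 × Fin 4 → K) :=
    Submodule.span K ↑(T.image fun p => (Pi.single p (1 : K) : Fin 4 × Fin 4 → K)) with hCdef
  have hCle : finrank K C ≤ 6 := by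
    rw [hCdef]
    exact (finrank_span_finset_le_card _).trans (Finset.card_image_le.trans hTcard.le)
  have hVC : V ≤ C := by
    intro y hy
    have hy0 : ∀ p, p ∉ T → y p = 0 := by
      intro p hp
      rw [memT] at hp
      by_cases hpx : p = x₁
      · rw [hpx]; exact hV0 y hy
      · have hnc : ¬ (p.1 = 3 ∨ p.2 = 3) := fun hc => hp ⟨hc, hpx⟩
        push Not at hnc
        have := hX y hy p.1 p.2 hnc.1 hnc.2
        simpa using this
    have hdecomp : y = ∑ p ∈ T, y p • (Pi.single p (1 : K) : Fin 4 × Fin 4 → K) :=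
      calc y = ∑ p, (Pi.single p (y p) : Fin 4 × Fin 4 → K) := (Finset.univ_sum_single y).symm
        _ = ∑ p ∈ T, (Pi.single p (y p) : Fin 4 × Fin 4 → K) := by
          symm
          refine Finset.sum_subset (Finset.subset_univ T) fun p _ hp => ?_
          rw [hy0 p hp, Pi.single_zero]
        _ = ∑ p ∈ T, y p • (Pi.single p (1 : K) : Fin 4 × Fin 4 → K) :=
          Finset.sum_congr rfl fun p _ => by
            ext p'
            by_cases hp : p' = p
            · subst hp; simp
            · simp [hp]
    rw [hdecomp]
    refine Submodule.sum_mem _ fun p hp => Submodule.smul_mem _ _ ?_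
    rw [hCdef]
    exact Submodule.subset_span (Finset.mem_coe.2 (Finset.mem_image_of_mem _ hp))
  have hVeq : V = C := Submodule.eq_of_le_of_finrank_le hVC (hCle.trans h6.ge)
  have hsum : (fun p : Fin 4 × Fin 4 => if (p.1 = 3 ∨ p.2 = 3) ∧ p ≠ x₁ then (1 : K) else 0) =
      ∑ p ∈ T, (Pi.single p (1 : K) : Fin 4 × Fin 4 → K) := by
    ext p'
    rw [Finset.sum_apply]
    have : (∑ p ∈ T, (Pi.single p (1 : K) : Fin 4 × Fin 4 → K) p') =
        ∑ p ∈ T, (if p' = p then (1 : K) else 0) :=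
      Finset.sum_congr rfl fun p _ => by rw [Pi.single_apply]
    rw [this, Finset.sum_ite_eq]
    by_cases h : (p'.1 = 3 ∨ p'.2 = 3) ∧ p' ≠ x₁
    · rw [if_pos h, if_pos ((memT p').2 h)]
    · rw [if_neg h, if_neg (fun hm => h ((memT p').1 hm))]
  rw [hsum, hVeq, hCdef]
  exact Submodule.sum_mem _ fun p hp =>
    Submodule.subset_span (Finset.mem_coe.2 (Finset.mem_image_of_mem _ hp))

/-- **No six-dimensional subspace of the cross `X₃₃` has `rank Hess per_4 ≤ 5` everywhere.**
[folklore] -/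
theorem false_of_le_cross33_six_of_sum_sq_swap [CharZero K] {ι : Type*} [Fintype ι]
    (hι : Fintype.card ι < 6) (V : Submodule K (Fin 4 × Fin 4 → K))
    (hX : ∀ x ∈ V, ∀ i j : Fin 4, i ≠ 3 → j ≠ 3 → x (i, j) = 0) (h6 : finrank K V = 6)
    (hW : ∀ y ∈ V, ∃ (c : ι → K) (Λ : ι → ((Fin 4 × Fin 4 → K) →ₗ[K] K)),
      ∀ u : Fin 4 × Fin 4 → K, ∃ e₀ e₁ : K, ∀ s : K,
        eval (u + s • y) (perPoly (Fin 4) K) = e₀ + s * e₁ + s ^ 2 * ∑ k, c k * (Λ k u) ^ 2) :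
    False := by
  classical
  -- the row product for the arm row `0`, as a product of six coordinate functionals
  let f : Fin 3 ⊕ Fin 3 → ((Fin 4 × Fin 4 → K) →ₗ[K] K) := fun t =>
    Sum.elim (fun k => LinearMap.proj ((3 : Fin 4), (Fin.castSucc k : Fin 4)))
      (fun _ => LinearMap.proj ((0 : Fin 4), (3 : Fin 4))) t
  have hprod : ∀ y ∈ V, ∏ t ∈ (Finset.univ : Finset (Fin 3 ⊕ Fin 3)), f t y = 0 := by
    intro y hy
    have h := rowProd_eq_zero_of_cross33 hι y (hX y hy) (hW y hy) 0 (by decide)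
    rw [Fintype.prod_sum_type]
    simp only [f, Sum.elim_inl, Sum.elim_inr, LinearMap.coe_proj, Function.eval,
      Fin.prod_univ_three, Finset.prod_const, Finset.card_univ, Fintype.card_fin]
    have e0 : (Fin.castSucc (0 : Fin 3) : Fin 4) = 0 := rfl
    have e1 : (Fin.castSucc (1 : Fin 3) : Fin 4) = 1 := rfl
    have e2 : (Fin.castSucc (2 : Fin 3) : Fin 4) = 2 := rfl
    rw [e0, e1, e2]
    linear_combination h
  obtain ⟨t, -, ht⟩ := exists_forall_eq_zero_of_prod_eq_zero V f Finset.univ hprod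
  -- the vanishing coordinate: an arm cell `x₁` of row `3` (column `< 3`) or the cell `(0, 3)`
  obtain ⟨x₁, hx₁V, hx₁⟩ : ∃ x₁ : Fin 4 × Fin 4, (∀ y ∈ V, y x₁ = 0) ∧
      ((x₁.1 = 3 ∧ x₁.2 ≠ 3) ∨ x₁ = (0, 3)) := by
    rcases t with k | k
    · refine ⟨((3 : Fin 4), (Fin.castSucc k : Fin 4)), fun y hy => ht y hy, Or.inl ⟨rfl, ?_⟩⟩
      exact Fin.castSucc_lt_last k |>.ne
    · exact ⟨((0 : Fin 4), (3 : Fin 4)), fun y hy => ht y hy, Or.inr rfl⟩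
  have hx₁c : x₁.1 = 3 ∨ x₁.2 = 3 := by
    rcases hx₁ with ⟨h1, -⟩ | h
    · exact Or.inl h1
    · rw [h]; exact Or.inr rfl
  -- the indicator of the other six cross cells lies in `V`
  set y₁ : Fin 4 × Fin 4 → K :=
    fun p => if (p.1 = 3 ∨ p.2 = 3) ∧ p ≠ x₁ then (1 : K) else 0 with hy₁
  have hy₁V : y₁ ∈ V := indicator_mem_of_coord_vanish V hX h6 x₁ hx₁c hx₁V
  have hy₁one : ∀ p : Fin 4 × Fin 4, (p.1 = 3 ∨ p.2 = 3) → p ≠ x₁ → y₁ p = 1 := fun p hp hpx => by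
    simp [hy₁, hp, hpx]
  rcases hx₁ with ⟨h31, hne3⟩ | hx₀
  · -- `x₁ = (3, j₀)`: use the column product at a column `j' ∉ {3, j₀}`
    obtain ⟨j', hj'3, hj'x⟩ : ∃ j' : Fin 4, j' ≠ 3 ∧ j' ≠ x₁.2 := by
      by_cases h0 : x₁.2 = 0
      · exact ⟨1, by decide, by rw [h0]; decide⟩
      · exact ⟨0, by decide, fun h => h0 h.symm⟩
    have hcol := colProd_eq_zero_of_cross33 hι y₁ (hX y₁ hy₁V) (hW y₁ hy₁V) j' hj'3
    have hne : ∀ i : Fin 4, i ≠ 3 → ((i, (3 : Fin 4)) : Fin 4 × Fin 4) ≠ x₁ := by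
      intro i hi h
      have := congr_arg Prod.fst h
      simp only at this
      exact hi (this.trans h31)
    have h3j : (((3 : Fin 4), j') : Fin 4 × Fin 4) ≠ x₁ := by
      intro h
      exact hj'x (by rw [← h])
    rw [hy₁one (2, 3) (Or.inr rfl) (hne 2 (by decide)), hy₁one (1, 3) (Or.inr rfl) (hne 1 (by decide)),
      hy₁one (0, 3) (Or.inr rfl) (hne 0 (by decide)), hy₁one (3, j') (Or.inl rfl) h3j] at hcol
    norm_num at hcol
  · -- `x₁ = (0, 3)`: use the row product for the arm row `1`
    have hrow := rowProd_eq_zero_of_cross33 hι y₁ (hX y₁ hy₁V) (hW y₁ hy₁V) 1 (by decide)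
    have hne : ∀ j : Fin 4, (((3 : Fin 4), j) : Fin 4 × Fin 4) ≠ x₁ := by
      intro j h; rw [hx₀] at h; exact absurd (congr_arg Prod.fst h) (by simp)
    have h13 : (((1 : Fin 4), (3 : Fin 4)) : Fin 4 × Fin 4) ≠ x₁ := by
      rw [hx₀]; decide
    rw [hy₁one (3, 2) (Or.inl rfl) (hne 2), hy₁one (3, 1) (Or.inl rfl) (hne 1),
      hy₁one (3, 0) (Or.inl rfl) (hne 0), hy₁one (1, 3) (Or.inr rfl) h13] at hrow
    norm_num at hrow

/-! ### A general cross -/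

/-- **No six-dimensional subspace of a cross `X_{lc}` has `rank Hess per_4 ≤ 5` everywhere**
(transport of `false_of_le_cross33_six_of_sum_sq_swap` by row/column permutations). [folklore] -/
theorem false_of_le_cross_six_of_sum_sq_swap [CharZero K] {ι : Type*} [Fintype ι]
    (hι : Fintype.card ι < 6) (V : Submodule K (Fin 4 × Fin 4 → K)) {l c : Fin 4}
    (hX : ∀ x ∈ V, ∀ i j : Fin 4, i ≠ l → j ≠ c → x (i, j) = 0) (h6 : finrank K V = 6)
    (hW : ∀ y ∈ V, ∃ (c : ι → K) (Λ : ι → ((Fin 4 × Fin 4 → K) →ₗ[K] K)),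
      ∀ u : Fin 4 × Fin 4 → K, ∃ e₀ e₁ : K, ∀ s : K,
        eval (u + s • y) (perPoly (Fin 4) K) = e₀ + s * e₁ + s ^ 2 * ∑ k, c k * (Λ k u) ^ 2) :
    False := by
  set σ : Equiv.Perm (Fin 4) := Equiv.swap 3 l with hσ
  set τ : Equiv.Perm (Fin 4) := Equiv.swap 3 c with hτ
  set Φ : (Fin 4 × Fin 4 → K) ≃ₗ[K] (Fin 4 × Fin 4 → K) :=
    LinearEquiv.funCongrLeft K K (Equiv.prodCongr σ τ) with hΦ
  have hΦa : ∀ (x : Fin 4 × Fin 4 → K) (i j : Fin 4), Φ x (i, j) = x (σ i, τ j) := fun x i j => rfl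
  have hW' := sqFamilySwap_map V Φ (fun z => eval_perPoly_comp_prodCongr σ τ z) hW
  set V' := V.map Φ.toLinearMap with hV'def
  have hfin : finrank K V' = 6 := by rw [hV'def, LinearEquiv.finrank_map_eq, h6]
  have hX' : ∀ x ∈ V', ∀ i j : Fin 4, i ≠ 3 → j ≠ 3 → x (i, j) = 0 := by
    rintro _ ⟨x, hx, rfl⟩ i j hi hj
    show Φ x (i, j) = 0
    rw [hΦa]
    refine hX x hx (σ i) (τ j) (fun h => hi ?_) (fun h => hj ?_)
    · rw [hσ, Equiv.swap_apply_eq_iff, Equiv.swap_apply_right] at h; exact h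
    · rw [hτ, Equiv.swap_apply_eq_iff, Equiv.swap_apply_right] at h; exact h
  exact false_of_le_cross33_six_of_sum_sq_swap hι V' hX' hfin hW'

end Summit.ValiantsHypothesis.ValiantsHypothesis.Theorems.SymPencilPerFourSixDimCross

end
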